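import Summits.MatrixMultiplication.MatrixMultiplication.Theorems.SaturationLadderTransferLawRigidity
import Summits.MatrixMultiplication.MatrixMultiplication.Theorems.SaturationLadderFlatFormatsItems
import HarnessLib

/-!
# Route `SaturationLadder` — transfer law, chain file 3/3: the X-perfect length floor `log 4` and the
route's items read through the law, BY NAME (decomp-mm lens 1 «grading / quantitative ladder», gen 27)

Chain files 1–2 (`…TransferLaw`, `…TransferLawRigidity`, route-free) proved the laws of an exact single-base
certificate between matrix multiplication formats and the rigidity of the onset ladder under them.  Here:
* §1–§3 THE LENGTH FLOOR.  The entropy condition of the tree's X-perfect kernel (`omegaRect_xPerfect_eq`: `a + c = qb`,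
  `2η(1/(q+2)) + η(q/(q+2)) ≤ h((a+b)/((q+2)b))`) is, in integers, `(a+b)log(a+b) + (b+c)log(b+c) ≤ 2b log b +
  (a+c)log(a+c)` (`xPerfect_entropy_integer`), and implies `b < a` and the floor
  **`log 4 · b/(a−b) ≤ log((a+c)/b) + 1 − log 2`** (`lengthFloor_of_entropy`, `xPerfect_lengthFloor`): an X-perfect
  format of thinness `t = b/a` has length `log((a+c)/b) ≥ log 4 · t/(1−t) − O(1)`.  By chain file 2 the floor survives
  every exact transfer (`xPerfectBase_exact_lengthFloor`), and the proved rung `(k+1, k, 4^{k+2}k−k−1)` MEETS it with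
  the same slope: `log((a+c)/b) = log 4 · b/(a−b) + 2 log 4` (`cwFamily_length_eq`).  So inside the method class
  «X-perfect bases + exact single-base transfer» the saturation constant of `SubexpSaturation` (stmt-25909:
  `r ≤ exp(c/(1−t))` for EVERY `c > 0`) is EXACTLY `log 4` — the gap to the crux is LENGTH at every thinness
  `t ∈ (1/2,1)`, not thinness (critic g26 r2: X-perfect thinness has supremum `1`, unattained).
* §4 THE ONSET ITEMS.  `TailDescentTwo` (stmt-29474) and `SquareFromTwo` (stmt-29475) are flat-to-flat transfers DOWN
  the onset ladder; chain file 2 typed why the engine only moves UP it: from the far base `⟨p^k,p,p⟩` (`k ≥ 3`, the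
  item's hypothesis) every certificate of the level-two format has `U ≥ k+1 ≥ 4 > 3` (`tailDescentTwo_farBase_defect`),
  from the mirrored base `⟨p,p,p^k⟩` none is exact (`tailDescentTwo_mirrorBase_inexact`), and ANY exact matrix
  multiplication base for the level-two format yields `ω(1,2,1) = 3` by padding alone (`levelTwo_of_exact_certificate`)
  — the item's hypothesis is then idle; likewise the level-two base cannot exactly certify the cube
  (`squareFromTwo_levelTwoBase_inexact`) and an exact cube certificate presupposes a flat cube, i.e. the summit
  (`summit_of_exact_cube_certificate`).  Tags unchanged (29474 NEC·WEAKER·IDEA-NEEDED; 29475 DECLARED RESIDUAL 1/4).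
Support module beneath stmt-MatrixMultiplication-25909; closes no item; 0 sorry; no definitions.
[cite: AlmanDuanVassilevskaWilliamsXuXuZhou2025, Thm. 3.2 and §3.4; CoppersmithWinograd1990, §8 (pp. 268–269);
ChristandlLeGallLysikovZuiddam2020, Thm. 3.10 and Lemma 4.1; LottiRomani1983, §1 (p. 173); HuangPan1998, §2 eq. (2.8)]
-/

set_option linter.dupNamespace false

noncomputable section

open scoped BigOperators

namespace Summit.MatrixMultiplication.MatrixMultiplication.Theorems.SaturationLadderTransferLawItems

open Literature.Computability.AlgebraicComplexity
open Literature.Barriers.MatrixMultiplication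
open Summit.MatrixMultiplication.MatrixMultiplication.Theses.SaturationLadder
open Summit.MatrixMultiplication.MatrixMultiplication.Theorems.SaturationLadderExpSaturation
  (entropyX_eq)  -- landed, imported
open Summit.MatrixMultiplication.MatrixMultiplication.Theorems.SaturationLadderXPerfect
  (omegaRect_xPerfect_eq)  -- landed, imported
open Summit.MatrixMultiplication.MatrixMultiplication.Theorems.SaturationLadderFlatFormatsItems
  (flat_of_tight summit_iff_cube_flat)  -- landed, imported
open Summit.MatrixMultiplication.MatrixMultiplication.Theorems.SaturationLadderTransferLaw
  (exact_skeleton exact_base_tight exact_thinness_law exact_length_law)  -- chain file 1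
open Summit.MatrixMultiplication.MatrixMultiplication.Theorems.SaturationLadderTransferLawRigidity
  (exact_innerSquareTarget exact_farTarget_redundant exact_cubeTarget_base_cube farBase_innerSquareTarget_floor
    lengthFloor_transfer)  -- chain file 2

/-! ## 1. The X-perfect entropy condition in integers -/

/-- **The entropy condition in integers**: `a + c = qb`, `q ≥ 2`, `b ≥ 1` and
`2η(1/(q+2)) + η(q/(q+2)) ≤ h((a+b)/((q+2)b))` ⟹ `(a+b)log(a+b) + (b+c)log(b+c) ≤ 2b log b + (a+c)log(a+c)`
(i.e. `(a+b)^{a+b}(b+c)^{b+c} ≤ b^{2b}(a+c)^{a+c}`). [cite: AlmanDuanVassilevskaWilliamsXuXuZhou2025, Thm. 3.2] -/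
theorem xPerfect_entropy_integer (q a b c : ℕ) (hq : 2 ≤ q) (hb : 1 ≤ b) (hqb : q * b = a + c)
    (hent : 2 * Real.negMulLog (1 / ((q : ℝ) + 2)) + Real.negMulLog (1 - 2 * (1 / ((q : ℝ) + 2))) ≤
      Real.binEntropy (((a : ℝ) + b) / (((q : ℝ) + 2) * b))) :
    ((a : ℝ) + b) * Real.log ((a : ℝ) + b) + ((b : ℝ) + c) * Real.log ((b : ℝ) + c) ≤
      2 * (b : ℝ) * Real.log b + ((a : ℝ) + c) * Real.log ((a : ℝ) + c) := by
  have hq0 : (0 : ℝ) < q := by exact_mod_cast (by omega : 0 < q)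
  have hb0 : (0 : ℝ) < b := by exact_mod_cast hb
  have hQ : (0 : ℝ) < (q : ℝ) + 2 := by linarith
  have hM : (0 : ℝ) < ((q : ℝ) + 2) * b := mul_pos hQ hb0
  have hqbR : (q : ℝ) * b = (a : ℝ) + c := by exact_mod_cast hqb
  have ha0 : (0 : ℝ) ≤ a := Nat.cast_nonneg a
  have hc0 : (0 : ℝ) ≤ c := Nat.cast_nonneg c
  have hab0 : (0 : ℝ) < (a : ℝ) + b := by linarith
  have hbc0 : (0 : ℝ) < (b : ℝ) + c := by linarith
  rw [entropyX_eq (q : ℝ) hq0, Real.binEntropy_eq_negMulLog_add_negMulLog_one_sub] at hent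
  have e1 : (1 : ℝ) - ((a : ℝ) + b) / (((q : ℝ) + 2) * b) = ((b : ℝ) + c) / (((q : ℝ) + 2) * b) := by
    field_simp
    linarith
  rw [e1] at hent
  simp only [Real.negMulLog] at hent
  rw [Real.log_div hab0.ne' hM.ne', Real.log_div hbc0.ne' hM.ne', Real.log_mul hQ.ne' hb0.ne'] at hent
  have hac : Real.log ((a : ℝ) + c) = Real.log q + Real.log b := by
    rw [← hqbR, Real.log_mul hq0.ne' hb0.ne']
  rw [hac]
  have hent' := mul_le_mul_of_nonneg_left hent hM.le
  have eL : ((q : ℝ) + 2) * b * (Real.log ((q : ℝ) + 2) - q / ((q : ℝ) + 2) * Real.log q) =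
      ((q : ℝ) + 2) * b * Real.log ((q : ℝ) + 2) - (q : ℝ) * b * Real.log q := by
    field_simp
  have eR : ((q : ℝ) + 2) * b *
      (-(((a : ℝ) + b) / (((q : ℝ) + 2) * b)) * (Real.log ((a : ℝ) + b) - (Real.log ((q : ℝ) + 2) + Real.log b)) +
        -(((b : ℝ) + c) / (((q : ℝ) + 2) * b)) * (Real.log ((b : ℝ) + c) - (Real.log ((q : ℝ) + 2) + Real.log b))) =
      -(((a : ℝ) + b) * (Real.log ((a : ℝ) + b) - (Real.log ((q : ℝ) + 2) + Real.log b)) +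
        ((b : ℝ) + c) * (Real.log ((b : ℝ) + c) - (Real.log ((q : ℝ) + 2) + Real.log b))) := by
    field_simp
    ring
  rw [eL, eR] at hent'
  have k1 : ((a : ℝ) + c) * Real.log ((q : ℝ) + 2) = (q : ℝ) * b * Real.log ((q : ℝ) + 2) := by rw [hqbR]
  have k2 : ((a : ℝ) + c) * Real.log b = (q : ℝ) * b * Real.log b := by rw [hqbR]
  have k3 : ((a : ℝ) + c) * Real.log q = (q : ℝ) * b * Real.log q := by rw [hqbR]
  linarith

/-! ## 2. The length floor from the integer entropy condition -/

/-- **The entropy condition forces `b < a`** (given `b ≤ a`, which tightness supplies): at `a = b` it would read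
`2b log(2b) ≤ 2b log b`. [folklore] -/
theorem inner_lt_of_entropy {a b c : ℕ} (hb : 1 ≤ b) (hba : b ≤ a)
    (hE : ((a : ℝ) + b) * Real.log ((a : ℝ) + b) + ((b : ℝ) + c) * Real.log ((b : ℝ) + c) ≤
      2 * (b : ℝ) * Real.log b + ((a : ℝ) + c) * Real.log ((a : ℝ) + c)) : b < a := by
  rcases hba.lt_or_eq with h | h
  · exact h
  · exfalso
    subst h
    have hb0 : (0 : ℝ) < b := by exact_mod_cast hb
    have h2 : Real.log ((b : ℝ) + b) = Real.log 2 + Real.log b := by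
      rw [← two_mul, Real.log_mul (by norm_num) hb0.ne']
    rw [h2] at hE
    have hlog2 : 0 < Real.log 2 := Real.log_pos one_lt_two
    nlinarith

/-- **The length floor.**  `b ≥ 1`, `b < a` and the integer entropy condition give
`2b·log 2 ≤ (a−b)·(log(a+c) − log(a+b) + 1)` and hence `log 4 · b/(a−b) ≤ log((a+c)/b) + 1 − log 2`
(`log(s−d) ≥ log s − d/(s−d)` at `s = a+c`, `d = a−b`; `log(a+b) ≥ log 2 + log b`). [folklore] -/
theorem lengthFloor_of_entropy {a b c : ℕ} (hb : 1 ≤ b) (hba : b < a)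
    (hE : ((a : ℝ) + b) * Real.log ((a : ℝ) + b) + ((b : ℝ) + c) * Real.log ((b : ℝ) + c) ≤
      2 * (b : ℝ) * Real.log b + ((a : ℝ) + c) * Real.log ((a : ℝ) + c)) :
    2 * (b : ℝ) * Real.log 2 ≤ ((a : ℝ) - b) * (Real.log ((a : ℝ) + c) - Real.log ((a : ℝ) + b) + 1) ∧
    Real.log 4 * ((b : ℝ) / ((a : ℝ) - b)) ≤ Real.log (((a : ℝ) + c) / b) + 1 - Real.log 2 := by
  have hbR : (1 : ℝ) ≤ b := by exact_mod_cast hb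
  have hbaR : (b : ℝ) + 1 ≤ a := by exact_mod_cast hba
  have hc0 : (0 : ℝ) ≤ c := Nat.cast_nonneg c
  have hb0 : (0 : ℝ) < b := by linarith
  have hd : (0 : ℝ) < (a : ℝ) - b := by linarith
  have hs0 : (0 : ℝ) < (a : ℝ) + c := by linarith
  have hbc0 : (0 : ℝ) < (b : ℝ) + c := by linarith
  have hab0 : (0 : ℝ) < (a : ℝ) + b := by linarith
  -- `(b+c)·(log(a+c) − log(b+c)) ≤ a − b`
  have h1 : Real.log (((a : ℝ) + c) / ((b : ℝ) + c)) ≤ ((a : ℝ) + c) / ((b : ℝ) + c) - 1 :=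
    Real.log_le_sub_one_of_pos (div_pos hs0 hbc0)
  rw [Real.log_div hs0.ne' hbc0.ne'] at h1
  have h1' : ((b : ℝ) + c) * (Real.log ((a : ℝ) + c) - Real.log ((b : ℝ) + c)) ≤ (a : ℝ) - b := by
    have := mul_le_mul_of_nonneg_left h1 hbc0.le
    have e : ((b : ℝ) + c) * (((a : ℝ) + c) / ((b : ℝ) + c) - 1) = ((a : ℝ) + c) - ((b : ℝ) + c) := by
      field_simp
    rw [e] at this
    linarith
  -- `log 2 + log b ≤ log(a+b)`
  have h2 : Real.log 2 + Real.log b ≤ Real.log ((a : ℝ) + b) := by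
    rw [← Real.log_mul (by norm_num) hb0.ne']
    exact Real.log_le_log (by positivity) (by linarith)
  have h2b := mul_le_mul_of_nonneg_left h2 (by linarith : (0 : ℝ) ≤ 2 * (b : ℝ))
  have hΦ : 2 * (b : ℝ) * Real.log 2 ≤
      ((a : ℝ) - b) * (Real.log ((a : ℝ) + c) - Real.log ((a : ℝ) + b) + 1) := by
    linarith
  refine ⟨hΦ, ?_⟩
  have h4 : Real.log 4 = 2 * Real.log 2 := by
    rw [show (4 : ℝ) = 2 ^ 2 by norm_num, Real.log_pow]; push_cast; ring
  rw [h4, Real.log_div hs0.ne' hb0.ne', show 2 * Real.log 2 * ((b : ℝ) / ((a : ℝ) - b)) =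
    2 * (b : ℝ) * Real.log 2 / ((a : ℝ) - b) by ring, div_le_iff₀ hd]
  have h2d := mul_le_mul_of_nonneg_left h2 hd.le
  nlinarith

/-! ## 3. X-perfect formats obey the floor; the floor survives exact transfer; the proved rung meets it -/

/-- **Every X-perfect format obeys the length floor**: `a + c = qb` (`q ≥ 2`, `b ≥ 1`) and the entropy condition
⟹ `b < a`, `b < c` (so the format lies in the class `J₃` of chain file 2) and `log 4 · b/(a−b) ≤ log((a+c)/b) + 1 −
log 2`; in thin coordinates `t = b/a`, `r = c/a`:
`log 4 · t/(1−t) ≤ log((1+r)/t) + 1 − log 2`. [cite: AlmanDuanVassilevskaWilliamsXuXuZhou2025, Thm. 3.2; CoppersmithWinograd1990, §8 (pp. 268–269)] -/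
theorem xPerfect_lengthFloor (q a b c : ℕ) (hq : 2 ≤ q) (hb : 1 ≤ b) (hqb : q * b = a + c)
    (hent : 2 * Real.negMulLog (1 / ((q : ℝ) + 2)) + Real.negMulLog (1 - 2 * (1 / ((q : ℝ) + 2))) ≤
      Real.binEntropy (((a : ℝ) + b) / (((q : ℝ) + 2) * b))) :
    b < a ∧ b < c ∧
      Real.log 4 * ((b : ℝ) / ((a : ℝ) - b)) ≤ Real.log (((a : ℝ) + c) / b) + 1 - Real.log 2 := by
  have hE := xPerfect_entropy_integer q a b c hq hb hqb hent
  have hT := omegaRect_xPerfect_eq q a b c hq hb hqb hent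
  have h23 := add_le_omegaRect₂₃ ℂ (a : ℝ) b c
  have h12 := add_le_omegaRect₁₂ ℂ (a : ℝ) b c
  rw [hT] at h23 h12
  have hba : b ≤ a := by exact_mod_cast (by linarith : (b : ℝ) ≤ a)
  have hbc : b ≤ c := by exact_mod_cast (by linarith : (b : ℝ) ≤ c)
  have hlt := inner_lt_of_entropy hb hba hE
  -- the integer condition is symmetric in `a ↔ c`
  have hE' := hE
  rw [show ((b : ℝ) + c) = (c : ℝ) + b from add_comm _ _, show ((a : ℝ) + c) = (c : ℝ) + a from add_comm _ _,
    show ((a : ℝ) + b) = (b : ℝ) + a from add_comm _ _] at hE'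
  have hlt' := inner_lt_of_entropy (a := c) (c := a) hb hbc (by linarith)
  exact ⟨hlt, hlt', (lengthFloor_of_entropy hb hlt hE).2⟩

/-- **The floor survives exact transfer from an X-perfect base.**  If a power of an X-perfect format
`⟨p^{a'},p^{b'},p^{c'}⟩` (`a' + c' = q₀b'`, entropy condition) exactly certifies `⟨t⟩ ⊗ ⟨q^a,q^b,q^c⟩` with `b ≥ 1`,
then `b < a` and `log 4 · b/(a−b) ≤ log((a+c)/b) + 1 − log 2`: targets of thinness `b/a → 1` reached this way have
length `≥ exp(log 4 · b/(a−b) − O(1))`, short of `SubexpSaturation`'s `exp(c·a/(a−b))` for every `c < log 4`.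
[cite: AlmanDuanVassilevskaWilliamsXuXuZhou2025, Thm. 3.2; ChristandlLeGallLysikovZuiddam2020, Thm. 3.10 and Lemma 4.1] -/
theorem xPerfectBase_exact_lengthFloor {q₀ a' b' c' p N t q a b c : ℕ} (hq₀ : 2 ≤ q₀) (hb' : 1 ≤ b')
    (hqb' : q₀ * b' = a' + c')
    (hent' : 2 * Real.negMulLog (1 / ((q₀ : ℝ) + 2)) + Real.negMulLog (1 - 2 * (1 / ((q₀ : ℝ) + 2))) ≤
      Real.binEntropy (((a' : ℝ) + b') / (((q₀ : ℝ) + 2) * b')))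
    (hp : 2 ≤ p) (hq : 2 ≤ q) (ht : 1 ≤ t) (hb : 1 ≤ b) (hac : 1 ≤ a + c)
    (h : PolyDegeneratesTo (kroneckerPow (matMulTensor ℂ (p ^ a') (p ^ b') (p ^ c')) N)
      (kroneckerTensor (unitTensor ℂ t) (matMulTensor ℂ (q ^ a) (q ^ b) (q ^ c))))
    (hU : ((N : ℝ) * (omegaRect ℂ a' b' c' * Real.log p) - Real.log t) / Real.log q ≤ ((a + c : ℕ) : ℝ)) :
    b < a ∧ Real.log 4 * ((b : ℝ) / ((a : ℝ) - b)) ≤ Real.log (((a : ℝ) + c) / b) + 1 - Real.log 2 := by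
  obtain ⟨hlt', -, hfloor'⟩ := xPerfect_lengthFloor q₀ a' b' c' hq₀ hb' hqb' hent'
  exact lengthFloor_transfer hb hb' hlt' (exact_thinness_law hp hq ht h hac hU)
    (exact_length_law hp hq ht h hac hU) hfloor'

/-- **The proved rung meets the floor with the same slope.**  The member `(a,b,c) = (k+1, k, 4^{k+2}k − k − 1)` of
the route's unconditional family (`flat_cwFamily`, X-perfect with `q = 4^{k+2}`: `entropyCondition_four_pow`) has
`b/(a−b) = k` and `log((a+c)/b) = log 4 · b/(a−b) + 2·log 4`: against the floor `log((a+c)/b) ≥ log 4 · b/(a−b) −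
(1 − log 2)`, the in-class saturation constant is EXACTLY `log 4`. [cite: AlmanDuanVassilevskaWilliamsXuXuZhou2025, Thm. 3.2; CoppersmithWinograd1990, §8 (pp. 268–269)] -/
theorem cwFamily_length_eq (k : ℕ) (hk : 1 ≤ k) :
    (((k : ℝ) : ℝ) / ((((k + 1 : ℕ)) : ℝ) - k)) = k ∧
    Real.log (((((k + 1 : ℕ)) : ℝ) + (((4 ^ (k + 2) * k - (k + 1) : ℕ)) : ℝ)) / k) =
      Real.log 4 * (k : ℝ) + 2 * Real.log 4 := by
  have hk0 : (0 : ℝ) < k := by exact_mod_cast hk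
  have hle : k + 1 ≤ 4 ^ (k + 2) * k := by
    have h16 : 16 ≤ 4 ^ (k + 2) := by
      have := Nat.pow_le_pow_right (by norm_num : 0 < 4) (by omega : 2 ≤ k + 2)
      simpa using this
    nlinarith
  refine ⟨by push_cast; field_simp; ring, ?_⟩
  have e : ((((k + 1 : ℕ)) : ℝ) + (((4 ^ (k + 2) * k - (k + 1) : ℕ)) : ℝ)) / k = (4 : ℝ) ^ (k + 2) := by
    rw [Nat.cast_sub hle]; push_cast; field_simp; ring
  rw [e, Real.log_pow]; push_cast; ring

/-! ## 4. The onset items through the law, by name -/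

variable {p N t q : ℕ}

/-- **`TailDescentTwo` (stmt-29474) from its own hypothesis' format: defect `≥ k − 2 ≥ 1`.**  Every certificate
from a power of the far format `⟨p^k,p,p⟩` for `⟨t⟩ ⊗ ⟨q²,q,q⟩` has certified exponent `U ≥ ω(k,1,1) ≥ k + 1`; for
`k ≥ 3` this exceeds the flat value `3`, so no such certificate is exact.
[cite: ChristandlLeGallLysikovZuiddam2020, Thm. 3.10 and Lemma 4.1; AlmanDuanVassilevskaWilliamsXuXuZhou2025, §3.4] -/
theorem tailDescentTwo_farBase_defect {k : ℕ} (hk : 3 ≤ k) (hp : 2 ≤ p) (hq : 2 ≤ q) (ht : 1 ≤ t)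
    (h : PolyDegeneratesTo (kroneckerPow (matMulTensor ℂ (p ^ k) (p ^ 1) (p ^ 1)) N)
      (kroneckerTensor (unitTensor ℂ t) (matMulTensor ℂ (q ^ 2) (q ^ 1) (q ^ 1)))) :
    (k : ℝ) + 1 ≤ ((N : ℝ) * (omegaRect ℂ k 1 1 * Real.log p) - Real.log t) / Real.log q ∧
    ¬ ((N : ℝ) * (omegaRect ℂ k 1 1 * Real.log p) - Real.log t) / Real.log q ≤ ((2 + 1 : ℕ) : ℝ) := by
  obtain ⟨h1, h2⟩ := farBase_innerSquareTarget_floor (K := ℂ) k hp hq ht h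
  push_cast at h1 h2 ⊢
  have hk3 : (3 : ℝ) ≤ k := by exact_mod_cast hk
  constructor
  · linarith
  · intro hU; linarith

/-- **`TailDescentTwo` from the mirrored far format: never exact.**  No power of `⟨p,p,p^k⟩` (`k ≥ 2`) exactly
certifies `⟨t⟩ ⊗ ⟨q²,q,q⟩`: an inner-square target forces `c' = b'` (chain file 2), i.e. `k = 1`.
[cite: ChristandlLeGallLysikovZuiddam2020, Thm. 3.10 and Lemma 4.1] -/
theorem tailDescentTwo_mirrorBase_inexact {k : ℕ} (hk : 2 ≤ k) (hp : 2 ≤ p) (hq : 2 ≤ q) (ht : 1 ≤ t)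
    (h : PolyDegeneratesTo (kroneckerPow (matMulTensor ℂ (p ^ 1) (p ^ 1) (p ^ k)) N)
      (kroneckerTensor (unitTensor ℂ t) (matMulTensor ℂ (q ^ 2) (q ^ 1) (q ^ 1)))) :
    ¬ ((N : ℝ) * (omegaRect ℂ (1 : ℕ) (1 : ℕ) k * Real.log p) - Real.log t) / Real.log q ≤ ((2 + 1 : ℕ) : ℝ) := by
  intro hU
  obtain ⟨hc, -, -⟩ := exact_innerSquareTarget (K := ℂ) hp hq ht le_rfl h hU
  omega

/-- **Any exact matrix multiplication base for the level-two format already gives `E₂`.**  If a power of SOME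
`⟨p^{a'},p^{b'},p^{c'}⟩` exactly certifies `⟨t⟩ ⊗ ⟨q²,q,q⟩`, then `ω(1,2,1) = 3` follows from the base by padding —
the hypothesis of `TailDescentTwo` (`E_k`, `k ≥ 3`) is idle in every in-class proof of its conclusion.
[cite: LottiRomani1983, §1 (p. 173); ChristandlLeGallLysikovZuiddam2020, Thm. 3.10] -/
theorem levelTwo_of_exact_certificate {a' b' c' : ℕ} (hp : 2 ≤ p) (hq : 2 ≤ q) (ht : 1 ≤ t)
    (h : PolyDegeneratesTo (kroneckerPow (matMulTensor ℂ (p ^ a') (p ^ b') (p ^ c')) N)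
      (kroneckerTensor (unitTensor ℂ t) (matMulTensor ℂ (q ^ 2) (q ^ 1) (q ^ 1))))
    (hU : ((N : ℝ) * (omegaRect ℂ a' b' c' * Real.log p) - Real.log t) / Real.log q ≤ ((2 + 1 : ℕ) : ℝ)) :
    omegaRect ℂ 1 2 1 = 3 := by
  have h2 := exact_farTarget_redundant (K := ℂ) (j := 2) (b := 1) hp hq ht le_rfl h hU
  rw [omegaRect_swap₁₂ (K := ℂ)]
  push_cast at h2 ⊢
  linarith [h2]

/-- **`SquareFromTwo` (stmt-29475) from its own hypothesis' format: never exact.**  No power of the level-two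
format `⟨p²,p,p⟩` exactly certifies the cube `⟨t⟩ ⊗ ⟨q,q,q⟩` (a cube target forces `a' = b'`).
[cite: ChristandlLeGallLysikovZuiddam2020, Thm. 3.10 and Lemma 4.1; Strassen1988, §3] -/
theorem squareFromTwo_levelTwoBase_inexact (hp : 2 ≤ p) (hq : 2 ≤ q) (ht : 1 ≤ t)
    (h : PolyDegeneratesTo (kroneckerPow (matMulTensor ℂ (p ^ 2) (p ^ 1) (p ^ 1)) N)
      (kroneckerTensor (unitTensor ℂ t) (matMulTensor ℂ (q ^ 1) (q ^ 1) (q ^ 1)))) :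
    ¬ ((N : ℝ) * (omegaRect ℂ (2 : ℕ) (1 : ℕ) (1 : ℕ) * Real.log p) - Real.log t) / Real.log q ≤
      ((1 + 1 : ℕ) : ℝ) := by
  intro hU
  obtain ⟨ha, -, -⟩ := exact_cubeTarget_base_cube (K := ℂ) hp hq ht le_rfl h hU
  omega

/-- **An exact cube certificate presupposes the summit.**  If a power of some `⟨p^{a'},p^{b'},p^{c'}⟩` exactly
certifies `⟨t⟩ ⊗ ⟨q,q,q⟩`, the base is a TIGHT CUBE `a' = b' = c' ≥ 1`, whence `ω = 2`: inside the class, the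
summit is certified only from a flat cube — from itself. [cite: Strassen1988, §3; ChristandlLeGallLysikovZuiddam2020, Thm. 3.10] -/
theorem summit_of_exact_cube_certificate {a' b' c' : ℕ} (hp : 2 ≤ p) (hq : 2 ≤ q) (ht : 1 ≤ t)
    (h : PolyDegeneratesTo (kroneckerPow (matMulTensor ℂ (p ^ a') (p ^ b') (p ^ c')) N)
      (kroneckerTensor (unitTensor ℂ t) (matMulTensor ℂ (q ^ 1) (q ^ 1) (q ^ 1))))
    (hU : ((N : ℝ) * (omegaRect ℂ a' b' c' * Real.log p) - Real.log t) / Real.log q ≤ ((1 + 1 : ℕ) : ℝ)) :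
    a' = b' ∧ c' = b' ∧ 1 ≤ b' ∧ _root_.MatrixMultiplication := by
  obtain ⟨ha, hc, hT⟩ := exact_cubeTarget_base_cube (K := ℂ) hp hq ht le_rfl h hU
  obtain ⟨-, hY, hL, -, -, -, p2, -⟩ := exact_skeleton (K := ℂ) hp hq ht h (by omega) hU
  have hb' : 1 ≤ b' := by
    by_contra h0
    have h0' : (b' : ℝ) = 0 := by exact_mod_cast (by omega : b' = 0)
    have ha' : (a' : ℝ) = 0 := by exact_mod_cast (by omega : a' = 0)
    rw [h0', ha'] at p2
    push_cast at p2
    nlinarith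
  refine ⟨ha, hc, hb', ?_⟩
  have hpb : 2 ≤ p ^ b' := le_trans hp (Nat.le_self_pow (by omega) p)
  refine (summit_iff_cube_flat hpb).2 (flat_of_tight hp ?_)
  rw [hT]; push_cast; ring

end Summit.MatrixMultiplication.MatrixMultiplication.Theorems.SaturationLadderTransferLawItems

end
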